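import Mathlib
import Literature.FieldTheory.Separability.PIndependentDerivations
import Literature.AlgebraicGeometry.Resolution.RegularDerivationQuotient
import Literature.AlgebraicGeometry.Resolution.DerivationCompletion
import Literature.AlgebraicGeometry.Resolution.SmoothStandardSmoothRetract
import Literature.AlgebraicGeometry.Resolution.FormalFibresRegularDerivations
import Summits.ResolutionOfSingularities.ResolutionOfSingularities.Theorems.PAlterationPicoverToRadicialBottomRootField

/-!
# `PAlteration.PicoverToRadicialBottom`, line `theta-finite-cofinite-roots`: the radical tower

Helper file of the line lead (stub `stub_cofiniteRegularTwist`): **adjoining `p`-th roots of a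
family `S ⊆ k` that is `p`-independent over `k^p(C)` keeps `k(θ F) ⊗_k A` regular** for every
finite `F ⊆ S`, when the regular `k`-algebra `A` carries, for every derivation `δ` of `k` killing
`C`, a derivation restricting to `δ` on `k` (e.g. `A = k[x]/(G)` with the coefficients of `G` in
`C`: `exists_derivation_extends_of_presentation`). The inductive step is Stacks 07PG/07PR
(`isRegularRing_tensor_of_minpoly_eq_X_pow_sub_C`, in tree) with the glued derivation
`D' ⊗ 1 + 1 ⊗ D_A` of `k(θ F) ⊗_k A` (`tensorProductDerivation`, in tree), where `D'` extends the
dual derivation `δ_b` (`δ_b b = 1`, `δ_b = 0` on `k^p(C ∪ S ∖ {b})`) to `k(θ F)`. Also: the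
Frobenius `ψ : k(θ S) → k` and its finiteness when `k = k^p(S ∪ C)`.
-/

noncomputable section

-- single-problem summit: the doubled namespace component `ResolutionOfSingularities` is forced
set_option linter.dupNamespace false

open Polynomial TensorProduct Literature.FieldTheory.Separability
  Literature.AlgebraicGeometry.Resolution

namespace Summit.ResolutionOfSingularities.ResolutionOfSingularities.Theorems

variable {p : ℕ} [Fact p.Prime] {k : Type} [Field k] [CharP k p]

variable {p : ℕ} [Fact p.Prime] {k : Type} [Field k] [CharP k p]

/-! ## Derivations of a presented algebra extending a derivation of the coefficient field -/

/-- **A derivation of `k` killing the coefficients of a presentation extends to the presented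
algebra**: if `A = k[x₁,…,xₙ]/(G)` (a surjection `π` with kernel generated by `G`) and the
derivation `δ` of `k` kills every coefficient of every `g ∈ G`, then there is a derivation `D` of
`A` with `D a = δ a` for `a ∈ k` (apply `δ` coefficientwise, `xᵢ ↦ 0`; this preserves `(G)`).
[folklore] -/
theorem exists_derivation_extends_of_presentation {n : ℕ} {A : Type} [CommRing A] [Algebra k A]
    (π : MvPolynomial (Fin n) k →ₐ[k] A) (hπ : Function.Surjective π)
    (G : Set (MvPolynomial (Fin n) k)) (hker : RingHom.ker π = Ideal.span G)
    (δ : Derivation ℤ k k) (hG : ∀ g ∈ G, ∀ m, δ (g.coeff m) = 0) :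
    ∃ D : Derivation ℤ A A, ∀ a : k, D (algebraMap k A a) = algebraMap k A (δ a) := by
  classical
  let Dt : Derivation ℤ (MvPolynomial (Fin n) k) (MvPolynomial (Fin n) k) :=
    coeffwiseDerivation (ι := Fin n) δ
  -- `D̃ g = 0` for `g ∈ G`
  have hDtG : ∀ g ∈ G, Dt g = 0 := fun g hg => by
    conv_lhs => rw [g.as_sum]
    rw [map_sum]
    refine Finset.sum_eq_zero fun m _ => ?_
    change coeffwiseDerivation (ι := Fin n) δ (MvPolynomial.monomial m (g.coeff m)) = 0
    rw [coeffwiseDerivation_monomial, hG g hg m, map_zero]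
  -- `D̃` preserves the kernel `(G)`
  have hmem : ∀ x, x ∈ Ideal.span G → Dt x ∈ Ideal.span G := by
    intro x hxmem
    induction hxmem using Submodule.span_induction with
    | mem g hg => rw [hDtG g hg]; exact Submodule.zero_mem _
    | zero => rw [map_zero]; exact Submodule.zero_mem _
    | add x y _ _ ihx ihy => rw [map_add]; exact Submodule.add_mem _ ihx ihy
    | smul r x hxG ih =>
      rw [smul_eq_mul, Derivation.leibniz, smul_eq_mul, smul_eq_mul]
      exact Submodule.add_mem _ (Ideal.mul_mem_left _ _ ih) (Ideal.mul_mem_right _ _ hxG)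
  let f : MvPolynomial (Fin n) k →ₐ[ℤ] A := π.toRingHom.toIntAlgHom
  have hf : Function.Surjective f := hπ
  have hker' : ∀ x, f x = 0 → f (Dt x) = 0 := by
    intro x hx
    have hx' : x ∈ RingHom.ker π := hx
    rw [hker] at hx'
    have h := hmem x hx'
    rw [← hker] at h
    exact h
  refine ⟨Derivation.liftOfSurjective (f := f) hf hker', fun a => ?_⟩
  have h1 : algebraMap k A a = f (algebraMap k (MvPolynomial (Fin n) k) a) := (π.commutes a).symm
  rw [h1, Derivation.liftOfSurjective_apply]
  change π (coeffwiseDerivation (ι := Fin n) δ (algebraMap k (MvPolynomial (Fin n) k) a)) = _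
  rw [MvPolynomial.algebraMap_eq, coeffwiseDerivation_C, ← MvPolynomial.algebraMap_eq, AlgHom.commutes]

/-! ## The inductive regularity of `k(θ F) ⊗_k A` -/

variable {Ω : Type} [Field Ω] [Algebra k Ω] (θ : k → Ω) (hθ : ∀ a : k, θ a ^ p = algebraMap k Ω a)

/-- Transport of regularity of `E ⊗_k A` along an equality of intermediate fields. [folklore] -/
theorem isRegularRing_tensor_of_eq {E₁ E₂ : IntermediateField k Ω} (h : E₁ = E₂) (A : Type)
    [CommRing A] [Algebra k A] (hreg : IsRegularRing (E₁ ⊗[k] A)) : IsRegularRing (E₂ ⊗[k] A) := by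
  subst h
  exact hreg

include hθ in
/-- **The radical tower keeps `k(θ F) ⊗_k A` regular.** Let `S ⊆ k` be `p`-independent over
`k^p(C)` (`b ∉ k^p(C ∪ S ∖ {b})` for `b ∈ S`) and let the regular `k`-algebra `A` admit, for every
derivation `δ` of `k` vanishing on `C`, a derivation restricting to `δ`. Then for every finite
`F ⊆ S` the ring `k(θ F) ⊗_k A` is regular (`θ` = chosen `p`-th roots in `Ω`). Induction on `F`:
the step `F ↦ F ∪ {b}` is Stacks 07PG for `k(θ F)(θ b) = k(θ F)[z]/(z^p - b)` with the derivation
`D' ⊗ 1 + 1 ⊗ D_A`, `D'` extending the dual derivation `δ_b` (`δ_b b = 1`) to `k(θ F)`.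
[folklore] -/
theorem isRegularRing_adjoin_roots_tensor (A : Type) [CommRing A] [Algebra k A] [IsRegularRing A]
    (C S : Set k) (hS : ∀ b ∈ S, b ∉ pAdjoin p (C ∪ (S \ {b})))
    (hA : ∀ δ : Derivation ℤ k k, (∀ c ∈ C, δ c = 0) →
      ∃ D : Derivation ℤ A A, ∀ a : k, D (algebraMap k A a) = algebraMap k A (δ a)) :
    ∀ F : Finset k, (↑F : Set k) ⊆ S →
      IsRegularRing (IntermediateField.adjoin k (θ '' (↑F : Set k)) ⊗[k] A) := by
  classical
  haveI : ExpChar k p := ExpChar.prime Fact.out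
  intro F
  induction F using Finset.induction_on with
  | empty =>
    intro _
    have hbot : IntermediateField.adjoin k (θ '' ((∅ : Finset k) : Set k)) = ⊥ := by
      rw [Finset.coe_empty, Set.image_empty, IntermediateField.adjoin_empty]
    refine isRegularRing_tensor_of_eq hbot.symm A ?_
    let e : (⊥ : IntermediateField k Ω) ⊗[k] A ≃ₐ[k] A :=
      (Algebra.TensorProduct.congr (IntermediateField.botEquiv k Ω) (AlgEquiv.refl : A ≃ₐ[k] A)).trans
        (Algebra.TensorProduct.lid k A)
    exact IsRegularRing.of_ringEquiv e.symm.toRingEquiv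
  | insert b F hbF ih =>
    intro hsub
    have hbS : b ∈ S := hsub (Finset.mem_insert_self b F)
    have hFS : (↑F : Set k) ⊆ S := fun x hx => hsub (Finset.mem_insert_of_mem hx)
    have hFS' : (↑F : Set k) ⊆ S \ {b} := fun x hx =>
      ⟨hFS hx, fun h => hbF (by rw [Set.mem_singleton_iff.mp h] at hx; exact hx)⟩
    haveI hreg : IsRegularRing (IntermediateField.adjoin k (θ '' (↑F : Set k)) ⊗[k] A) := ih hFS
    set L := IntermediateField.adjoin k (θ '' (↑F : Set k)) with hL
    -- the dual derivation `δ_b` of `k`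
    obtain ⟨δ, hδb, hδ0⟩ := exists_derivation_eq_one_eqOn_zero p (pAdjoin p (C ∪ (S \ {b})))
      (pow_mem_pAdjoin _) (hS b hbS)
    have hδC : ∀ c ∈ C, δ c = 0 := fun c hc => hδ0 c (subset_pAdjoin _ (Or.inl hc))
    have hδF : ∀ t ∈ (↑F : Set k), δ t = 0 := fun t ht => hδ0 t (subset_pAdjoin _ (Or.inr (hFS' ht)))
    -- its extensions to `A` and to `L = k(θ F)`, glued on `L ⊗_k A`
    obtain ⟨DA, hDA⟩ := hA δ hδC
    obtain ⟨DL, hDL⟩ := exists_derivation_adjoin_roots_extends θ hθ (↑F : Set k) δ hδF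
    let dA : Derivation ℤ L (L ⊗[k] A) := (Algebra.linearMap L (L ⊗[k] A)).compDer DL
    have hdA : ∀ x : L, dA x = DL x ⊗ₜ[k] (1 : A) := fun x => rfl
    have hcomp : ∀ c : k, dA (algebraMap k L c) = (1 : L) ⊗ₜ[k] DA (algebraMap k A c) := by
      intro c
      rw [hdA, hDL, hDA, Algebra.algebraMap_eq_smul_one, Algebra.algebraMap_eq_smul_one,
        TensorProduct.smul_tmul]
    let 𝔇 := tensorProductDerivation dA DA hcomp
    -- `b ∉ k^p(F)`, minimal polynomial `z^p - b`
    have hbF' : b ∉ pAdjoin p (↑F : Set k) := fun h =>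
      hS b hbS (pAdjoin_mono (fun x hx => Or.inr (hFS' hx)) h)
    have hmin := minpoly_root_eq_X_pow_sub_C θ hθ (↑F : Set k) hbF'
    have hint : IsIntegral L (θ b) := isIntegral_root θ hθ (↑F : Set k) b
    -- the radical step
    have hstep : IsRegularRing (IntermediateField.adjoin L {θ b} ⊗[k] A) := by
      refine isRegularRing_tensor_of_minpoly_eq_X_pow_sub_C (R := k) (T := A) (F := L)
        (θ := IntermediateField.AdjoinSimple.gen L (θ b))
        (IntermediateField.isIntegral_iff.mpr hint) (adjoin_adjoinSimpleGen_eq_top hint)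
        (by rw [IntermediateField.minpoly_gen, hmin]) 𝔇 ?_
      change IsUnit (𝔇 ((algebraMap k L b) ⊗ₜ[k] (1 : A)))
      rw [tensorProductDerivation_tmul_one]
      change IsUnit (DL (algebraMap k L b) ⊗ₜ[k] (1 : A))
      rw [hDL, hδb, map_one, ← Algebra.TensorProduct.one_def]
      exact isUnit_one
    -- `k(θ F)(θ b) = k(θ (F ∪ {b}))`
    have heq : (IntermediateField.adjoin L {θ b}).restrictScalars k =
        IntermediateField.adjoin k (θ '' (↑(insert b F) : Set k)) := by
      rw [hL, IntermediateField.adjoin_adjoin_left, Finset.coe_insert, Set.image_insert_eq,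
        Set.union_singleton]
    exact isRegularRing_tensor_of_eq heq A hstep





/-! ## The Frobenius `ψ : k(θ S) → k` and its finiteness -/

section Psi

include hθ in
/-- **The Frobenius of `k(θ S)` lands in `k`**: there is a ring homomorphism `ψ : k(θ S) → k` with
`ψ x = x^p` (in `Ω`), `ψ a = a^p` for `a ∈ k` and `ψ (θ s) = s` for `s ∈ S`. [folklore] -/
theorem exists_rootField_frobenius (S : Set k) :
    ∃ ψ : IntermediateField.adjoin k (θ '' S) →+* k,
      (∀ x, algebraMap k (IntermediateField.adjoin k (θ '' S)) (ψ x) = x ^ p) ∧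
      (∀ a : k, ψ (algebraMap k _ a) = a ^ p) ∧
      ∀ (s : k) (hs : θ s ∈ IntermediateField.adjoin k (θ '' S)), ψ ⟨θ s, hs⟩ = s := by
  classical
  set L := IntermediateField.adjoin k (θ '' S)
  haveI : CharP Ω p := charP_of_injective_algebraMap (algebraMap k Ω).injective p
  let ι := algebraMap k Ω
  have hι : Function.Injective ι := ι.injective
  have hex : ∀ x : L, ∃ y : k, ι y = (x : Ω) ^ p := fun x => by
    obtain ⟨y, -, hy⟩ := exists_mem_pAdjoin_algebraMap_eq_pow θ hθ S x.2
    exact ⟨y, hy⟩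
  choose f hf using hex
  let ψ : L →+* k :=
    { toFun := f
      map_one' := hι (by rw [hf]; simp)
      map_mul' := fun x y => hι (by rw [hf, map_mul, hf, hf]; simp [mul_pow])
      map_zero' := hι (by rw [hf, map_zero]; simp [(Fact.out : p.Prime).ne_zero])
      map_add' := fun x y => hι (by rw [hf, map_add, hf, hf]; simp [add_pow_char]) }
  refine ⟨ψ, fun x => ?_, fun a => hι ?_, fun s hs => hι ?_⟩
  · apply Subtype.ext
    change ι (f x) = ((x ^ p : L) : Ω)
    rw [hf, IntermediateField.coe_pow]
  · change ι (f (algebraMap k L a)) = ι (a ^ p)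
    rw [hf, map_pow]
    rfl
  · change ι (f ⟨θ s, hs⟩) = ι s
    rw [hf, ← hθ s]

/-- **Finite codegree**: if `k = k^p(S ∪ C)` with `C` finite and `ψ : L → k` is a ring
homomorphism whose range contains all `p`-th powers and `S`, then `k` is finite over `ψ(L)`,
i.e. `ψ` is finite. [folklore] -/
theorem ringHom_finite_of_pAdjoin_eq_top {L : Type} [Field L] (S : Set k) (C : Finset k)
    (hSC : pAdjoin p (S ∪ ↑C) = ⊤) (ψ : L →+* k) (hpow : ∀ a : k, a ^ p ∈ ψ.fieldRange)
    (hS : ∀ s ∈ S, s ∈ ψ.fieldRange) : ψ.Finite := by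
  classical
  haveI : ExpChar k p := ExpChar.prime Fact.out
  set M : Subfield k := ψ.fieldRange with hM
  -- `k = M(C)` is finite over `M`
  have hint : ∀ c ∈ (↑C : Set k), IsIntegral M c := fun c _ =>
    ⟨X ^ p - Polynomial.C ⟨c ^ p, hpow c⟩, monic_X_pow_sub_C _ (Fact.out : p.Prime).ne_zero, by
      simp only [eval₂_sub, eval₂_X_pow, eval₂_C]
      exact sub_self _⟩
  haveI : FiniteDimensional M (IntermediateField.adjoin M (↑C : Set k)) :=
    IntermediateField.finiteDimensional_adjoin hint
  have htop : IntermediateField.adjoin M (↑C : Set k) = ⊤ := by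
    rw [eq_top_iff]
    intro x _
    have hx : x ∈ pAdjoin p (S ∪ ↑C) := by rw [hSC]; trivial
    have hle : pAdjoin p (S ∪ ↑C) ≤ (IntermediateField.adjoin M (↑C : Set k)).toSubfield := by
      rw [pAdjoin, Subfield.closure_le]
      rintro y (⟨z, rfl⟩ | hy | hy)
      · exact (IntermediateField.adjoin M (↑C : Set k)).algebraMap_mem ⟨_, hpow z⟩
      · exact (IntermediateField.adjoin M (↑C : Set k)).algebraMap_mem ⟨_, hS y hy⟩
      · exact IntermediateField.subset_adjoin M _ hy
    exact hle hx
  haveI : FiniteDimensional M k := by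
    have e := ((IntermediateField.equivOfEq htop).trans IntermediateField.topEquiv :
      IntermediateField.adjoin M (↑C : Set k) ≃ₐ[M] k)
    exact LinearEquiv.finiteDimensional e.toLinearEquiv
  -- `ψ = (M ⊆ k) ∘ (L ↠ M)`
  have h1 : (ψ.rangeRestrictField).Finite :=
    RingHom.Finite.of_surjective _ ψ.rangeRestrictField_bijective.surjective
  have h2 : M.subtype.Finite := by
    change Module.Finite M k
    infer_instance
  have hcomp : ψ = M.subtype.comp ψ.rangeRestrictField := by
    ext x
    rfl
  rw [hcomp]
  exact h2.comp h1

end Psi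


/-- **Registered form** of `isRegularRing_adjoin_roots_tensor` (all binders explicit).
[folklore] -/
theorem adjoinRootsTensor_isRegularRing : ∀ (p : ℕ) [Fact p.Prime] (k : Type) [Field k]
    [CharP k p] (Ω : Type) [Field Ω] [Algebra k Ω] (θ : k → Ω),
    (∀ a : k, θ a ^ p = algebraMap k Ω a) → ∀ (A : Type) [CommRing A] [Algebra k A]
    [IsRegularRing A] (C S : Set k), (∀ b ∈ S, b ∉ pAdjoin p (C ∪ (S \ {b}))) →
    (∀ δ : Derivation ℤ k k, (∀ c ∈ C, δ c = 0) →
      ∃ D : Derivation ℤ A A, ∀ a : k, D (algebraMap k A a) = algebraMap k A (δ a)) →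
    ∀ F : Finset k, (↑F : Set k) ⊆ S →
      IsRegularRing (IntermediateField.adjoin k (θ '' (↑F : Set k)) ⊗[k] A) :=
  fun _ _ _ _ _ _ _ _ θ hθ A _ _ _ C S hS hA => isRegularRing_adjoin_roots_tensor θ hθ A C S hS hA

end Summit.ResolutionOfSingularities.ResolutionOfSingularities.Theorems

end
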